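import Literature.AlgebraicGeometry.Resolution.StrictNormalCrossings
import Literature.AlgebraicGeometry.Resolution.MarkedIdeals
import Mathlib.AlgebraicGeometry.AffineScheme
import Mathlib.RingTheory.DiscreteValuationRing.Basic
import Mathlib.RingTheory.KrullDimension.PID
import HarnessLib

/-!
# Strict normal crossings divisors: isolated points with discrete valuation rings

Topic: `Literature/AlgebraicGeometry/Resolution`. A first genuine family of instances of
`IsStrictNormalCrossingsDivisor` (`StrictNormalCrossings.lean`; de Jong 1996, 2.4 / Stacks 0BI9),
exercising its stalk/germ formulation (review of p13390, finding 1): **a closed subset all of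
whose points are isolated in it and have a discrete valuation ring as local ring is a strict
normal crossings divisor** — at such a point `p` the regular system of parameters is a
uniformizer `ϖ` of `𝒪_{X,p}` (`r = 1`, `e = 0`) and the ideal of `Z` at `p` is `𝔪_p = (ϖ)`.
This is the shape of every boundary in dimension one (finitely many closed points on a regular
curve, e.g. `X̄₁ ∖ X₁` in de Jong's Thm. 4.1 for `dim X = 1`, loc. cit. 4.3), and in particular
of a single closed point `{p}` with `𝒪_{X,p}` a discrete valuation ring
(`isStrictNormalCrossingsDivisor_singleton`).

## Content

* `isStrictNormalCrossingsDivisor_iff_stalkIdeal` — the last clause of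
  `IsStrictNormalCrossingsDivisor` restated with the stalk `Literature.AlgebraicGeometry.Resolution.stalkIdeal` of
  `MarkedIdeals.lean` (`(I_Z)_p = (x₁ ⋯ x_r)`), as promised in the docstring of the definition;
  `IsStrictNormalCrossingsDivisor.of_exists_affineOpen` — it suffices to check the clause on ONE
  affine open neighbourhood (chart independence, `Literature.AlgebraicGeometry.Resolution.map_germ_eq_map_germ`).
* `vanishingIdeal_ideal_eq_primeIdealOf` — if `U ∩ Z = {p}` for an affine open `U`, then
  `I_Z(U)` is the prime ideal of `p` in `Γ(X, U)`; hence `I_Z(U) · 𝒪_{X,p} = 𝔪_p`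
  (`vanishingIdeal_map_germ_eq_maximalIdeal`).
* `IsStrictNormalCrossingsDivisor.of_isolated_of_isDiscreteValuationRing` and
  `isStrictNormalCrossingsDivisor_singleton`.

## Sources

* A. J. de Jong, *Smoothness, semi-stability and alterations*, Publ. Math. IHÉS 83 (1996), 2.4
  (p. 55), 4.3 (p. 66).
* The Stacks Project, Tag 0BI9.
-/

noncomputable section

open CategoryTheory AlgebraicGeometry TopologicalSpace IsLocalRing

universe u

namespace Literature.AlgebraicGeometry.Resolution

open Scheme.IdealSheafData

variable {X : Scheme.{u}}

/-! ## The stalk form of the definition; independence of the affine chart -/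

/-- `IsStrictNormalCrossingsDivisor` with its last clause written as an equality of ideals of the
local ring, `(I_Z)_p = (x₁ ⋯ x_r)` with `(I_Z)_p = stalkIdeal (vanishingIdeal Z) p`
(`MarkedIdeals.lean`): the stalk is generated by the germs of `I_Z(U)` for any affine open
`U ∋ p` (`stalkIdeal_eq_map_germ`). [cite: DeJong1996, 2.4, p. 55] -/
theorem isStrictNormalCrossingsDivisor_iff_stalkIdeal (X : Scheme.{u}) (Z : Set X) :
    IsStrictNormalCrossingsDivisor X Z ↔ IsClosed Z ∧ ∀ p ∈ Z,
      IsRegularLocalRing (X.presheaf.stalk p) ∧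
      ∃ (r e : ℕ) (x : Fin r → X.presheaf.stalk p) (y : Fin e → X.presheaf.stalk p),
        1 ≤ r ∧ ringKrullDim (X.presheaf.stalk p) = (r + e : ℕ) ∧
        Ideal.span (Set.range x ∪ Set.range y) = maximalIdeal (X.presheaf.stalk p) ∧
        stalkIdeal (vanishingIdeal ⟨closure Z, isClosed_closure⟩) p = Ideal.span {∏ i, x i} := by
  refine and_congr_right fun _ => forall₂_congr fun p _ => and_congr_right fun _ => ?_
  refine exists₄_congr fun r e x y => and_congr_right fun _ => and_congr_right fun _ =>
    and_congr_right fun _ => ⟨fun h => ?_, fun h U hU => ?_⟩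
  · obtain ⟨_, ⟨U, hU, rfl⟩, hpU, -⟩ :=
      X.isBasis_affineOpens.exists_subset_of_mem_open (Set.mem_univ p) isOpen_univ
    rw [stalkIdeal_eq_map_germ _ ⟨U, hU⟩ hpU, h ⟨U, hU⟩ hpU]
  · rw [← stalkIdeal_eq_map_germ _ U hU, h]

/-- It suffices to verify the last clause of `IsStrictNormalCrossingsDivisor` on ONE affine
open neighbourhood of each point. [folklore] -/
theorem IsStrictNormalCrossingsDivisor.of_exists_affineOpen {Z : Set X} (hZ : IsClosed Z)
    (h : ∀ p ∈ Z, IsRegularLocalRing (X.presheaf.stalk p) ∧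
      ∃ (r e : ℕ) (x : Fin r → X.presheaf.stalk p) (y : Fin e → X.presheaf.stalk p),
        1 ≤ r ∧ ringKrullDim (X.presheaf.stalk p) = (r + e : ℕ) ∧
        Ideal.span (Set.range x ∪ Set.range y) = maximalIdeal (X.presheaf.stalk p) ∧
        ∃ (U : X.affineOpens) (hU : p ∈ (U : X.Opens)),
          ((vanishingIdeal ⟨closure Z, isClosed_closure⟩).ideal U).map
            (X.presheaf.germ U p hU).hom = Ideal.span {∏ i, x i}) :
    IsStrictNormalCrossingsDivisor X Z := by
  refine ⟨hZ, fun p hp => ⟨(h p hp).1, ?_⟩⟩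
  obtain ⟨r, e, x, y, hr, hdim, hspan, U, hU, hUZ⟩ := (h p hp).2
  refine ⟨r, e, x, y, hr, hdim, hspan, fun V hV => ?_⟩
  rw [map_germ_eq_map_germ _ V U hV hU, hUZ]

/-! ## The ideal of `Z` near an isolated point -/

/-- If an affine open `U` meets the closed set `Z` exactly in the point `p`, then the sections of
the vanishing ideal sheaf of `Z` over `U` form the prime ideal of `p` in `Γ(X, U)`
(`vanishingIdeal {𝔭} = 𝔭`). [folklore] -/
theorem vanishingIdeal_ideal_eq_primeIdealOf {Z : Set X} (hZ : IsClosed Z) {p : X}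
    (U : X.affineOpens) (hpU : p ∈ (U : X.Opens)) (hUZ : (U : Set X) ∩ Z = {p}) :
    (vanishingIdeal ⟨Z, hZ⟩).ideal U = (U.2.primeIdealOf ⟨p, hpU⟩).asIdeal := by
  rw [vanishingIdeal_ideal, ← PrimeSpectrum.vanishingIdeal_singleton]
  congr 1
  ext q
  rw [Set.mem_singleton_iff]
  constructor
  · intro hq
    have hq' : U.2.fromSpec q ∈ (U : Set X) ∩ Z := ⟨U.2.range_fromSpec ▸ ⟨q, rfl⟩, hq⟩
    rw [hUZ, Set.mem_singleton_iff] at hq'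
    apply U.2.fromSpec.isOpenEmbedding.injective
    rw [hq', U.2.fromSpec_primeIdealOf ⟨p, hpU⟩]
  · rintro rfl
    change U.2.fromSpec (U.2.primeIdealOf ⟨p, hpU⟩) ∈ Z
    rw [U.2.fromSpec_primeIdealOf ⟨p, hpU⟩]
    exact (hUZ.symm.subset (Set.mem_singleton p)).2

/-- In the situation of `vanishingIdeal_ideal_eq_primeIdealOf`, the ideal of `Z` in the local
ring at `p` is the maximal ideal: `I_Z(U) · 𝒪_{X,p} = 𝔭 · 𝒪_{X,p} = 𝔪_p`, the stalk being the
localisation of `Γ(X, U)` at `𝔭`. [folklore] -/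
theorem vanishingIdeal_map_germ_eq_maximalIdeal {Z : Set X} (hZ : IsClosed Z) {p : X}
    (U : X.affineOpens) (hpU : p ∈ (U : X.Opens)) (hUZ : (U : Set X) ∩ Z = {p}) :
    ((vanishingIdeal ⟨Z, hZ⟩).ideal U).map (X.presheaf.germ U p hpU).hom =
      maximalIdeal (X.presheaf.stalk p) := by
  rw [vanishingIdeal_ideal_eq_primeIdealOf hZ U hpU hUZ]
  letI := TopCat.Presheaf.algebra_section_stalk X.presheaf (⟨p, hpU⟩ : (U : X.Opens))
  haveI := U.2.isLocalization_stalk ⟨p, hpU⟩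
  exact IsLocalization.AtPrime.map_eq_maximalIdeal (U.2.primeIdealOf ⟨p, hpU⟩).asIdeal
    (X.presheaf.stalk p)

/-! ## Isolated points with discrete valuation rings -/

/-- **A closed subset all of whose points are isolated in it and have a discrete valuation ring
as local ring is a strict normal crossings divisor** (the case `r = 1`, `e = 0` of de Jong 1996,
2.4 / Stacks 0BI9: at `p ∈ Z`, `𝒪_{X,p}` is regular of dimension `1`, a uniformizer `ϖ` is a
regular system of parameters, and `Z` is cut out by `ϖ` since its ideal at `p` is `𝔪_p = (ϖ)`).
[cite: DeJong1996, 2.4, p. 55] -/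
theorem IsStrictNormalCrossingsDivisor.of_isolated_of_isDiscreteValuationRing {Z : Set X}
    (hZ : IsClosed Z) (hiso : ∀ p ∈ Z, ∃ U : X.Opens, p ∈ U ∧ (U : Set X) ∩ Z = {p})
    (hdvr : ∀ p ∈ Z, ∃ _ : IsDomain (X.presheaf.stalk p),
      IsDiscreteValuationRing (X.presheaf.stalk p)) :
    IsStrictNormalCrossingsDivisor X Z := by
  refine IsStrictNormalCrossingsDivisor.of_exists_affineOpen hZ fun p hp => ?_
  obtain ⟨hdom, hdvr⟩ := hdvr p hp
  refine ⟨inferInstance, ?_⟩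
  obtain ⟨ϖ, hϖ⟩ := IsDiscreteValuationRing.exists_irreducible (X.presheaf.stalk p)
  -- an affine open neighbourhood of `p` meeting `Z` only in `p`
  obtain ⟨W, hpW, hWZ⟩ := hiso p hp
  obtain ⟨_, ⟨U, hU, rfl⟩, hpU, hUW⟩ :=
    X.isBasis_affineOpens.exists_subset_of_mem_open hpW W.isOpen
  have hUZ : (U : Set X) ∩ Z = {p} := by
    refine Set.Subset.antisymm (fun z hz => hWZ.subset ⟨hUW hz.1, hz.2⟩) ?_
    rintro _ rfl
    exact ⟨hpU, hp⟩
  refine ⟨1, 0, fun _ => ϖ, Fin.elim0, le_rfl, ?_, ?_, ⟨U, hU⟩, hpU, ?_⟩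
  · rw [IsPrincipalIdealRing.ringKrullDim_eq_one _ (IsDiscreteValuationRing.not_isField _)]
    rfl
  · have h1 : Set.range (fun _ : Fin 1 => ϖ) = {ϖ} := Set.range_const
    have h0 : Set.range (Fin.elim0 : Fin 0 → X.presheaf.stalk p) = ∅ := Set.range_eq_empty _
    rw [h1, h0, Set.union_empty, hϖ.maximalIdeal_eq]
  · rw [Fin.prod_univ_one, ← hϖ.maximalIdeal_eq]
    have hcl : closure Z = Z := hZ.closure_eq
    have := vanishingIdeal_map_germ_eq_maximalIdeal hZ ⟨U, hU⟩ hpU hUZ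
    convert this using 4
    exact Closeds.ext hcl

/-- **A closed point whose local ring is a discrete valuation ring is a strict normal crossings
divisor** (e.g. a closed point of a Dedekind scheme / of a regular curve; the boundary points
`X̄₁ ∖ X₁` in de Jong 1996, Thm. 4.1 for `dim X = 1`, cf. 4.3). [cite: DeJong1996, 2.4, p. 55] -/
theorem isStrictNormalCrossingsDivisor_singleton {p : X} (hp : IsClosed ({p} : Set X))
    [IsDomain (X.presheaf.stalk p)] [IsDiscreteValuationRing (X.presheaf.stalk p)] :
    IsStrictNormalCrossingsDivisor X {p} := by
  refine IsStrictNormalCrossingsDivisor.of_isolated_of_isDiscreteValuationRing hp ?_ ?_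
  · rintro q rfl
    exact ⟨⊤, trivial, by simp⟩
  · rintro q rfl
    exact ⟨‹_›, ‹_›⟩

end Literature.AlgebraicGeometry.Resolution

end
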